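import Mathlib
import HarnessLib
import Summits.ResolutionOfSingularities.ResolutionOfSingularities.Theorems.WildQuotientsWildQuotientResolutionCotangentRep
import Summits.ResolutionOfSingularities.ResolutionOfSingularities.Theorems.WildQuotientsWildQuotientResolutionAbelianEigenline

/-!
# The WILD eigenline: a finite `p`-group acting on a local ring of residue characteristic `p` stabilises a
# tangent hyperplane (crux `WildQuotients.WildQuotientResolution`, stub `stub_phaseZeroHighDim`)

Crux stmt-ResolutionOfSingularities-15640 (`WildQuotientResolution`), registered stub `stub_phaseZeroHighDim`;
programme PHASE0-KS-EIGENLINE. The Kollár–Szabó blow-up fixed-point chain of hand 8-g2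
(✓`KSGoingDown.exists_fixedPoint_liftAction_step`, p829367) uses commutativity of the stabiliser at exactly one place:
the stable tangent hyperplane ✓`AbelianEigenline.exists_stable_tangentHyperplane` (common eigen-covector of commuting
matrices over an algebraically closed field). For WILD inertia — a finite `p`-GROUP acting on a local ring whose residue
field has characteristic `p`, the situation of the crux — the hyperplane exists WITHOUT commutativity and WITHOUT
algebraic closure, because a `p`-group acting linearly in characteristic `p` fixes a non-zero vector
(Serre, *Linear representations*, §8.3 Prop. 26). This file proves it, in the output format consumed by
✓`EigenlineChart.exists_rsop_adapted_to_hyperplane` / ✓`exists_equivariant_quadraticTransform`: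

* `exists_ne_zero_fixed_of_isPGroup` — a finite `p`-group acting `k`-linearly on a `k`-vector space (`char k = p`) fixes
  a non-zero vector of the `k`-span of any non-zero orbit (the `𝔽_p`-span of the orbit is a finite `p`-set with the
  fixed point `0`; Mathlib `IsPGroup.exists_fixed_point_of_prime_dvd_card_of_fixed_point`; proof pattern of the tree's
  `Literature.NumberTheory.Automorphic.exists_ne_zero_fixed_of_tendsto_pow_prime_pow`, minus the topology);
* `exists_ne_zero_fixed_covector_of_isPGroup` — dually, a non-zero FIXED COVECTOR `l ∘ ρ_h = l`;
* `exists_stable_tangentHyperplane_of_isPGroup` — **for a residue-trivial action `τ` of a finite `p`-group `I` on a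
  Noetherian local ring `(A, 𝔪, κ)`, not a field, with `char κ = p`: an ideal `𝔪² ≤ W < 𝔪` of codimension one
  (`W + (t) = 𝔪` for `t ∈ 𝔪 ∖ W`), stable under every `τ_g`** — verbatim the conclusion of the abelian eigenline, so
  ✓`AbelianEigenline.exists_unit_mul_sub_mem_of_not_mem` (already general) gives the unit eigenvalue on `𝔪/W`.

[OURS · crux stmt-ResolutionOfSingularities-15640 · helper toward `stub_phaseZeroHighDim` (wild eigenline for the
Kollár–Szabó blow-up step; NOT a proof of the stub); folklore, counted 0; AI-level work, weaker than expert review.]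
[folklore]
-/

-- single-problem summit: the doubled namespace component `ResolutionOfSingularities` is forced
set_option linter.dupNamespace false

noncomputable section

namespace Summit.ResolutionOfSingularities.ResolutionOfSingularities.Theorems.WildQuotientResolution.PGroupEigenline

open IsLocalRing Module
open Summit.ResolutionOfSingularities.ResolutionOfSingularities.Theorems.WildQuotientResolution

universe u v w

/-! ## A `p`-group acting linearly in characteristic `p` fixes a non-zero vector -/

section FixedVector

variable {k : Type u} [Field k] {p : ℕ} [Fact p.Prime] [CharP k p]
variable {V : Type v} [AddCommGroup V] [Module k V]
variable {H : Type w} [Group H] [Finite H]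

/-- **A finite `p`-group acting linearly on a vector space over a field of characteristic `p` fixes a non-zero
vector** in the span of any non-zero orbit: the `𝔽_p`-span `X` of the orbit of `v ≠ 0` is a finite `H`-stable
`p`-group containing the fixed point `0`, and `|X^H| ≡ |X| ≡ 0 (mod p)`.
[cite: SerreLinearRepresentations1977, §8.3 Prop. 26] -/
theorem exists_ne_zero_fixed_of_isPGroup (hH : IsPGroup p H) (ρ : H →* (V →ₗ[k] V)) {v : V}
    (hv : v ≠ 0) : ∃ w ∈ Submodule.span k (Set.range fun h : H => ρ h v), w ≠ 0 ∧ ∀ h : H, ρ h w = w := by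
  classical
  set S : Set V := Set.range fun h : H => ρ h v with hS_def
  have hSfin : S.Finite := Set.finite_range _
  have hvS : v ∈ S := ⟨1, by simp⟩
  have hS_stab : ∀ h : H, ∀ s ∈ S, ρ h s ∈ S := by
    rintro h _ ⟨h', rfl⟩
    exact ⟨h * h', by simp [map_mul]⟩
  -- `V` as an `𝔽_p`-vector space, `X` the `𝔽_p`-span of the orbit: a finite `H`-stable set
  letI : Module (ZMod p) V := Module.compHom V (ZMod.castHom (dvd_refl p) k)
  haveI : Module.Finite (ZMod p) ↥(Submodule.span (ZMod p) S) :=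
    Module.Finite.span_of_finite (ZMod p) hSfin
  haveI : Finite ↥(Submodule.span (ZMod p) S) := Module.finite_of_finite (ZMod p)
  have hX_stab : ∀ h : H, ∀ x ∈ Submodule.span (ZMod p) S, ρ h x ∈ Submodule.span (ZMod p) S := by
    intro h x hx
    induction hx using Submodule.span_induction with
    | mem s hs => exact Submodule.subset_span (hS_stab h s hs)
    | zero => simp
    | add x y _ _ hx hy => simpa only [map_add] using Submodule.add_mem _ hx hy
    | smul c x _ hx =>
        rw [ZMod.map_smul (ρ h) c x]
        exact Submodule.smul_mem _ c hx
  -- the permutation action of `H` on `X`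
  let e : H → Equiv.Perm ↥(Submodule.span (ZMod p) S) := fun h =>
    { toFun := fun x => ⟨ρ h x, hX_stab h x x.2⟩
      invFun := fun x => ⟨ρ h⁻¹ x, hX_stab _ x x.2⟩
      left_inv := fun x => Subtype.ext (by
        simp only
        rw [← Module.End.mul_apply, ← map_mul, inv_mul_cancel, map_one, Module.End.one_apply])
      right_inv := fun x => Subtype.ext (by
        simp only
        rw [← Module.End.mul_apply, ← map_mul, mul_inv_cancel, map_one, Module.End.one_apply]) }
  have e_apply : ∀ (h : H) (x : ↥(Submodule.span (ZMod p) S)),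
      ((e h x : ↥(Submodule.span (ZMod p) S)) : V) = ρ h x := fun h x => rfl
  let φ : H →* Equiv.Perm ↥(Submodule.span (ZMod p) S) :=
    { toFun := e
      map_one' := by
        ext x
        rw [e_apply]
        simp
      map_mul' := fun a b => by
        ext x
        simp only [Equiv.Perm.coe_mul, Function.comp_apply, e_apply, map_mul, Module.End.mul_apply] }
  letI : MulAction H ↥(Submodule.span (ZMod p) S) := MulAction.compHom _ φ
  have smul_def : ∀ (h : H) (x : ↥(Submodule.span (ZMod p) S)), ((h • x : ↥(Submodule.span (ZMod p) S)) : V)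
      = ρ h x := fun h x => rfl
  -- `|X| = p ^ d` with `d ≥ 1`
  have hcard : p ∣ Nat.card ↥(Submodule.span (ZMod p) S) := by
    haveI : Nontrivial ↥(Submodule.span (ZMod p) S) :=
      ⟨⟨⟨v, Submodule.subset_span hvS⟩, 0, fun h0 => hv (congrArg Subtype.val h0)⟩⟩
    rw [Module.natCard_eq_pow_finrank (K := ZMod p) (V := ↥(Submodule.span (ZMod p) S)),
      Nat.card_zmod]
    exact dvd_pow_self p (Module.finrank_pos (R := ZMod p) (M := ↥(Submodule.span (ZMod p) S))).ne'
  have h0 : (0 : ↥(Submodule.span (ZMod p) S)) ∈ MulAction.fixedPoints H ↥(Submodule.span (ZMod p) S) := by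
    intro h
    refine Subtype.ext ?_
    rw [smul_def, ZeroMemClass.coe_zero, map_zero]
  obtain ⟨b, hb, hb0⟩ := hH.exists_fixed_point_of_prime_dvd_card_of_fixed_point _ hcard h0
  refine ⟨(b : V), ?_, fun hb' => hb0 (Subtype.ext hb'.symm), fun h => ?_⟩
  · -- `X ⊆ span_k S`
    have hXle : ∀ x ∈ Submodule.span (ZMod p) S, x ∈ Submodule.span k S := by
      intro x hx
      induction hx using Submodule.span_induction with
      | mem s hs => exact Submodule.subset_span hs
      | zero => exact zero_mem _
      | add x y _ _ hx hy => exact add_mem hx hy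
      | smul c x _ hx => exact ZMod.smul_mem hx c
    exact hXle b b.2
  · have := hb h
    rw [← smul_def, this]

/-- **A finite `p`-group acting linearly in characteristic `p` fixes a non-zero COVECTOR**: some `l ≠ 0` in the
dual with `l ∘ ρ_h = l` for all `h` (apply `exists_ne_zero_fixed_of_isPGroup` to the contragredient action
`h ↦ (ρ_{h⁻¹})^∨` on the dual space). [cite: SerreLinearRepresentations1977, §8.3 Prop. 26] -/
theorem exists_ne_zero_fixed_covector_of_isPGroup [Module.Projective k V] [Nontrivial V] (hH : IsPGroup p H)
    (ρ : H →* (V →ₗ[k] V)) : ∃ l : Module.Dual k V, l ≠ 0 ∧ ∀ h : H, l ∘ₗ ρ h = l := by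
  -- the contragredient action on the dual
  let ρ' : H →* (Module.Dual k V →ₗ[k] Module.Dual k V) :=
    { toFun := fun h => (ρ h⁻¹).dualMap
      map_one' := by
        rw [inv_one, map_one]
        rfl
      map_mul' := fun a b => by
        rw [mul_inv_rev, map_mul]
        exact (LinearMap.dualMap_comp_dualMap (ρ a⁻¹) (ρ b⁻¹)).symm }
  -- a non-zero covector to start from
  obtain ⟨v, hv⟩ := exists_ne (0 : V)
  obtain ⟨l₀, hl₀⟩ : ∃ l₀ : Module.Dual k V, l₀ v ≠ 0 := by
    by_contra h
    simp only [not_exists, not_not] at h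
    exact hv ((Module.forall_dual_apply_eq_zero_iff k v).mp h)
  have hl₀0 : l₀ ≠ 0 := fun h => hl₀ (by rw [h]; rfl)
  obtain ⟨l, -, hl0, hl⟩ := exists_ne_zero_fixed_of_isPGroup hH ρ' hl₀0
  refine ⟨l, hl0, fun h => ?_⟩
  have := hl h⁻¹
  change (ρ (h⁻¹)⁻¹).dualMap l = l at this
  rwa [inv_inv, LinearMap.dualMap_apply'] at this

end FixedVector

/-! ## The wild eigenline: a stable tangent hyperplane for a `p`-group -/

section Hyperplane

variable {A : Type*} [CommRing A] [IsLocalRing A] [IsNoetherianRing A]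
variable {I : Type*} [Group I] [Finite I] (τ : I →* (A ≃+* A))
  (hres : ∀ (g : I) (a : A), τ g a - a ∈ maximalIdeal A)

include hres

/-- **Stable tangent hyperplane of a wild stabiliser.** For a residue-trivial action of a finite `p`-GROUP `I` on a
Noetherian local ring `(A, 𝔪, κ)`, not a field, with `char κ = p`, the action stabilises an ideal `𝔪² ≤ W ≤ 𝔪`,
`W ≠ 𝔪`, with `W + (t) = 𝔪` for every `t ∈ 𝔪 ∖ W` (the preimage of the kernel of a fixed covector of the cotangent
representation). Same conclusion as ✓`AbelianEigenline.exists_stable_tangentHyperplane`, without commutativity or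
algebraic closure. [cite: ReichsteinYoussin2000, Appendix, Lemma A.1 and proof of Prop. A.2] -/
theorem exists_stable_tangentHyperplane_of_isPGroup {p : ℕ} [Fact p.Prime] [CharP (ResidueField A) p]
    (hI : IsPGroup p I) (hA : ¬ IsField A) :
    ∃ W : Ideal A, maximalIdeal A ^ 2 ≤ W ∧ W ≤ maximalIdeal A ∧ W ≠ maximalIdeal A ∧
      (∀ t ∈ maximalIdeal A, t ∉ W → W ⊔ Ideal.span {t} = maximalIdeal A) ∧
      ∀ g : I, ∀ w ∈ W, τ g w ∈ W := by
  haveI := AbelianEigenline.nontrivial_cotangentSpace (A := A) hA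
  obtain ⟨φ, hφ⟩ := CotangentRep.exists_cotangentRep τ hres
  let ρ : I →* (CotangentSpace A →ₗ[ResidueField A] CotangentSpace A) :=
    (LinearEquiv.automorphismGroup.toLinearMapMonoidHom).comp φ
  have hρ : ∀ g, ρ g = (φ g : CotangentSpace A →ₗ[ResidueField A] CotangentSpace A) := fun g => rfl
  obtain ⟨l, hl, hel⟩ := exists_ne_zero_fixed_covector_of_isPGroup hI ρ
  -- `W` = the preimage in `𝔪` of the hyperplane `ker λ ⊆ 𝔪/𝔪²`
  let Wm : Submodule A (maximalIdeal A) :=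
    ((LinearMap.ker l).restrictScalars A).comap (maximalIdeal A).toCotangent
  let W : Ideal A := Wm.map (maximalIdeal A).subtype
  have memW : ∀ a : A, a ∈ W ↔ ∃ h : a ∈ maximalIdeal A, l ((maximalIdeal A).toCotangent ⟨a, h⟩) = 0 := by
    intro a
    constructor
    · rintro ⟨y, hy, rfl⟩
      exact ⟨y.2, by simpa [Wm] using hy⟩
    · rintro ⟨h, hl0⟩
      exact ⟨⟨a, h⟩, by simpa [Wm] using hl0, rfl⟩
  have hWle : W ≤ maximalIdeal A := fun a ha => by
    obtain ⟨h, -⟩ := (memW a).mp ha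
    exact h
  refine ⟨W, ?_, hWle, ?_, ?_, ?_⟩
  · -- `𝔪² ≤ W`
    intro a ha
    have ham : a ∈ maximalIdeal A := Ideal.pow_le_self two_ne_zero ha
    refine (memW a).mpr ⟨ham, ?_⟩
    rw [(Ideal.toCotangent_eq_zero (maximalIdeal A) ⟨a, ham⟩).mpr ha, map_zero]
  · -- `W ≠ 𝔪`: `λ ≠ 0`
    intro hWeq
    apply hl
    apply LinearMap.ext
    intro v
    obtain ⟨x, rfl⟩ := (maximalIdeal A).toCotangent_surjective v
    have hxW : (x : A) ∈ W := by rw [hWeq]; exact x.2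
    obtain ⟨h, h0⟩ := (memW x).mp hxW
    simpa using h0
  · -- hyperplane: `W + (t) = 𝔪` for `t ∈ 𝔪 ∖ W`
    intro t ht htW
    have hlt : l ((maximalIdeal A).toCotangent ⟨t, ht⟩) ≠ 0 := fun h0 => htW ((memW t).mpr ⟨ht, h0⟩)
    apply le_antisymm (sup_le hWle ((Ideal.span_singleton_le_iff_mem _).mpr ht))
    intro a ha
    obtain ⟨b, hb⟩ := IsLocalRing.residue_surjective
      (l ((maximalIdeal A).toCotangent ⟨a, ha⟩) / l ((maximalIdeal A).toCotangent ⟨t, ht⟩))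
    have habt : a - b * t ∈ maximalIdeal A :=
      sub_mem ha (Ideal.mul_mem_left _ b ht)
    have hW' : a - b * t ∈ W := by
      refine (memW _).mpr ⟨habt, ?_⟩
      have e : (⟨a - b * t, habt⟩ : maximalIdeal A) = ⟨a, ha⟩ - b • ⟨t, ht⟩ := by
        apply Subtype.ext
        simp
      rw [e, map_sub, ← AbelianEigenline.residue_smul_toCotangent, map_sub, LinearMap.map_smul, smul_eq_mul,
        hb, div_mul_cancel₀ _ hlt, sub_self]
    have e : a = (a - b * t) + b * t := by ring
    rw [e]
    exact Submodule.add_mem_sup hW' (Ideal.mul_mem_left _ b (Ideal.mem_span_singleton_self t))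
  · -- stability under `I` (the covector is FIXED: eigenvalue `1`)
    intro g w hw
    obtain ⟨hwm, hw0⟩ := (memW w).mp hw
    have hgw : τ g w ∈ maximalIdeal A := CotangentRep.maximalIdeal_le_comap (τ g) (hres g) hwm
    refine (memW _).mpr ⟨hgw, ?_⟩
    have h1 := hφ g ⟨w, hwm⟩
    have h2 := congrArg (fun f => f ((maximalIdeal A).toCotangent ⟨w, hwm⟩)) (hel g)
    simp only [LinearMap.coe_comp, Function.comp_apply, hρ, LinearEquiv.coe_coe] at h2
    rw [h1] at h2
    rw [h2, hw0]

end Hyperplane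

end Summit.ResolutionOfSingularities.ResolutionOfSingularities.Theorems.WildQuotientResolution.PGroupEigenline

end
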